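import Literature.AlgebraicGeometry.Resolution.InitialFormsChangeOfParameters
import Literature.AlgebraicGeometry.Resolution.HironakaDirectrixLemmas
import Literature.AlgebraicGeometry.Resolution.MarkedIdeals
import HarnessLib

/-!
# `τ(x)` at the points of a scheme; near and very near points (CoP1, proof of Prop. 4.2)

Topic: `Literature/AlgebraicGeometry/Resolution`. [CoP1] = Cossart–Piltant, J. Algebra 320
(2008), proof of Prop. 4.2, pp. 7–8:

> "Let `x ∈ Σ` be a closed point. We denote `R := 𝒪_{X,x}` … Let `τ(x) := dim_{k(x)}(T_x)`. …
> Let `E′ = (J′, μ)` where `J′ = I(Y)^{-μ} J` is the weak transform of `J`. … (a) For any point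
> `x′` above `x`, `ord_{x′} J′ ≤ μ`; if equality holds, we say that `x′` is near `x`. (b) If `x′`
> is near `x`, then `τ(x′) ≥ τ(x)`; if equality holds, we say that `x′` is very near `x`."

DEFINITIONS (with bodies) at the points of a scheme, and PROVED API:

* `stalkTau J x μ` — **`τ(x)` for the idealistic exponent `(J, μ)` at a point `x` with regular
  local ring**: `τ` of `cl_μ(J_x) ⊆ k(x)[Y_1, …, Y_d]` computed in any regular system of
  parameters of `𝒪_{X,x}` (`hironakaTauAt`, `HironakaDirectrix.lean`); `stalkTau_eq` — it may
  be computed in ANY regular system of parameters (`hironakaTauAt_eq_of_rsop`,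
  `InitialFormsChangeOfParameters.lean`); `stalkTau_le` (`τ(x) ≤ emb.dim 𝒪_{X,x}`),
  `one_le_stalkTau` (**`1 ≤ τ(x)` when `ord_x J = μ ≥ 1`**, i.e. at the points of `Σ`);
* `IsNear π C J μ x'`, `IsVeryNear π C J μ x'` — **near points** (`ord_{x′} J′ = μ` for the
  weak transform `J′ = (π^*J : 𝓘(E)^μ)`) and **very near points** (near and `τ(x′) = τ(π x′)`).

## Sources

* V. Cossart, O. Piltant, J. Algebra 320 (2008), proof of Prop. 4.2, pp. 7–8. [CossartPiltant2008]
-/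

noncomputable section

open CategoryTheory AlgebraicGeometry TopologicalSpace IsLocalRing MvPolynomial

namespace Literature.AlgebraicGeometry.Resolution

universe u

variable {X : Scheme.{u}}

/-! ## `τ(x)` -/

/-- **`τ(x)` of the idealistic exponent `(J, μ)` at a point `x` whose local ring is regular**
([CoP1]: `τ(x) := dim_{k(x)} T_x`, `T_x` the directrix of `cl_μ J_x`), computed in a chosen
regular system of parameters of `𝒪_{X,x}` — independent of that choice by `stalkTau_eq`.
[cite: CossartPiltant2008, proof of Prop. 4.2] -/
def stalkTau (J : X.IdealSheafData) (x : X) [IsRegularLocalRing (X.presheaf.stalk x)] (μ : ℕ) : ℕ :=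
  hironakaTauAt (Classical.choose (exists_regularSystemOfParameters (R := X.presheaf.stalk x)))
    (stalkIdeal J x) μ

/-- **`τ(x)` may be computed in any regular system of parameters.**
[cite: CossartPiltant2008, proof of Prop. 4.2] -/
theorem stalkTau_eq (J : X.IdealSheafData) (x : X) [IsRegularLocalRing (X.presheaf.stalk x)]
    (μ : ℕ) {d : ℕ} (hd : (maximalIdeal (X.presheaf.stalk x)).spanFinrank = d)
    (c : Fin d → X.presheaf.stalk x) (hc : Ideal.span (Set.range c) = maximalIdeal _) :
    stalkTau J x μ = hironakaTauAt c (stalkIdeal J x) μ := by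
  subst hd
  unfold stalkTau
  exact hironakaTauAt_eq_of_rsop rfl hc
    (Classical.choose_spec (exists_regularSystemOfParameters (R := X.presheaf.stalk x))) _ μ

/-- `τ(x) ≤ emb.dim 𝒪_{X,x}`. [cite: CossartPiltant2008, proof of Prop. 4.2] -/
theorem stalkTau_le (J : X.IdealSheafData) (x : X) [IsRegularLocalRing (X.presheaf.stalk x)]
    (μ : ℕ) : stalkTau J x μ ≤ (maximalIdeal (X.presheaf.stalk x)).spanFinrank :=
  hironakaTauAt_le _ _ _

/-- **`1 ≤ τ(x)` at a point with `ord_x J = μ ≥ 1`** (the points of `Σ` in [CoP1]: `cl_μ J_x`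
contains a non-zero form of degree `μ`). [cite: CossartPiltant2008, proof of Prop. 4.2] -/
theorem one_le_stalkTau (J : X.IdealSheafData) (x : X) [IsRegularLocalRing (X.presheaf.stalk x)]
    {μ : ℕ} (hμ : 1 ≤ μ) (hord : idealOrder J x = μ) : 1 ≤ stalkTau J x μ := by
  have hJ : stalkIdeal J x ≤ maximalIdeal _ ^ μ := (le_idealOrder_iff J x μ).mp hord.ge
  have hJ' : ¬ stalkIdeal J x ≤ maximalIdeal _ ^ (μ + 1) := by
    rw [← le_idealOrder_iff, hord]
    exact_mod_cast Nat.not_succ_le_self μ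
  exact one_le_hironakaTauAt _
    (Classical.choose_spec (exists_regularSystemOfParameters (R := X.presheaf.stalk x))) hμ hJ hJ'

/-! ## Near and very near points -/

variable {X' : Scheme.{u}}

/-- **`x′` is near (its image)** for the idealistic exponent `(J, μ)` and the blowing up `π`
with centre `C`: `ord_{x′} J′ = μ` for the weak transform `J′ = (π^*J : 𝓘(E)^μ)` ([CoP1] (a):
"`ord_{x′} J′ ≤ μ`; if equality holds, we say that `x′` is near `x`").
[cite: CossartPiltant2008, proof of Prop. 4.2 (a)] -/
def IsNear (π : X' ⟶ X) (C J : X.IdealSheafData) (μ : ℕ) (x' : X') : Prop :=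
  idealOrder (controlledTransform π C J μ) x' = μ

/-- **`x′` is very near (its image)**: near, and `τ(x′) = τ(π x′)` ([CoP1] (b): "If `x′` is near
`x`, then `τ(x′) ≥ τ(x)`; if equality holds, we say that `x′` is very near `x`").
[cite: CossartPiltant2008, proof of Prop. 4.2 (b)] -/
def IsVeryNear (π : X' ⟶ X) (C J : X.IdealSheafData) (μ : ℕ) (x' : X')
    [IsRegularLocalRing (X'.presheaf.stalk x')] [IsRegularLocalRing (X.presheaf.stalk (π x'))] :
    Prop :=
  IsNear π C J μ x' ∧ stalkTau (controlledTransform π C J μ) x' μ = stalkTau J (π x') μ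

/-- Unfolding `IsNear`. [folklore] -/
theorem isNear_iff {π : X' ⟶ X} {C J : X.IdealSheafData} {μ : ℕ} {x' : X'} :
    IsNear π C J μ x' ↔ idealOrder (controlledTransform π C J μ) x' = μ :=
  Iff.rfl

/-- A very near point is near. [folklore] -/
theorem IsVeryNear.isNear {π : X' ⟶ X} {C J : X.IdealSheafData} {μ : ℕ} {x' : X'}
    [IsRegularLocalRing (X'.presheaf.stalk x')] [IsRegularLocalRing (X.presheaf.stalk (π x'))]
    (h : IsVeryNear π C J μ x') : IsNear π C J μ x' :=
  h.1

/-- At a near point, `1 ≤ τ(x′)` when `μ ≥ 1`. [cite: CossartPiltant2008, proof of Prop. 4.2] -/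
theorem IsNear.one_le_stalkTau {π : X' ⟶ X} {C J : X.IdealSheafData} {μ : ℕ} {x' : X'}
    [IsRegularLocalRing (X'.presheaf.stalk x')] (h : IsNear π C J μ x') (hμ : 1 ≤ μ) :
    1 ≤ stalkTau (controlledTransform π C J μ) x' μ :=
  Literature.AlgebraicGeometry.Resolution.one_le_stalkTau _ x' hμ h

end Literature.AlgebraicGeometry.Resolution

end
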